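import Summits.ValiantsHypothesis.ValiantsHypothesis.Theorems.LacunarySymmetroidMatrixDescartesPivotRankOneCriticalWindowsLoneLetterLeft

/-!
# `MatrixDescartes` census — rank-one `(2,K)₁`: THE LONE-LETTER LAW FOR ANY RATES AND ANY NUMBER OF LETTERS

HONEST FRAMING.  Object-search cell `pub-symmetroid`, seat `val-sym-mdr-p1` (generation 24); helper file `--supports` the crux item
stmt-ValiantsHypothesis-18050 (`Theses.LacunarySymmetroid.MatrixDescartes`, OPEN, on HOLD) with NO closure claim.  This file REMOVES the
hypothesis «the lone letter carries the largest rate» from `…LoneLetter.lone_letter_right` / `…LoneLetterLeft.lone_letter_left`: for a pivot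
letter, any number (≥ 1) of letters below it with positive rates, and ONE letter beyond it with ANY positive rate, pencil-coupled exponents and
any positive weights, the window profile has at most two critical directions on the lone side.  A COUNT for ALL lone-side cells of the
rank-one `(2,K)₁` row (every `K`); the row's registers, the other splits, `MatrixDescartes` in its window, `DoorA26`/`DoorA34`, credences and
`VP ≠ VNP` are untouched.

THE NEW ARGUMENT (replaces the order-polytope step of `…LoneCubicMoment`; no «most negative atom» is needed).  In the abstract moment language
(masses `dₘ > 0`, `E U = E R = E[UR] = 0`, `gₘ = Uₘ + Rₘ`, `σ > 0` with `E U² − E R² = (∑d)σ²`; pivot `Uₚ > 0`, all other `Uₘ < 0`; left atoms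
`σ ≤ gₘ ≤ gₚ`; lone atom `gⱼ < 0`) put `wₘ := 2Uₘ − gₘ + σ`.  Three identities, each a one-line `Finset` computation:
* `E[w·(g − c)] = (∑d)·σ·(σ − c)` for every constant `c` (§1 `w_moment`);
* hence (§2) `c = gⱼ`: the left terms are `< 0`, the `j`-term vanishes, the total is `> 0` ⇒ `wₚ > 0` (`w_pivot_pos`); `c = gₚ`: the left terms
  are `≥ 0`, the `p`-term vanishes, the total is `< 0` ⇒ `wⱼ > 0` (`w_lone_pos`);
* `E U³ − E[UR²] = E[U·w·(g − σ)]` (§3 `phi_eq`) — and every term of the right side is positive (left: `U < 0`, `w < 0`, `g − σ ≥ 0`; pivot: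
  all three factors positive; lone: `U < 0`, `w > 0`, `g − σ < 0`).
So `E U³ − E[UR²] > 0`; with `…LoneCubicMoment.mixedCubic_nonpos` (`E[UR²] ≤ 0`, any rates) this gives `E U³ > 3E[UR²]`
(`cubicMoment_pos_allRates`).  The bridge of `…LoneFoldCubic` (free scalars) and `…LoneRequiredWeight.firstMoment_neg` (`S₁ < 0` for any rates)
turn it into `foldCubic_pos_allRates` (`𝒞_W > 0` at every fold point, any rates), which discharges the hypothesis `hC` of
`…LoneLetter.lone_letter_right_of_foldCubic_pos`.
[folklore] Polynomial identities summed over a `Finset`; sign bookkeeping.  No definitions, no named facts.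
-/

-- `Summit.ValiantsHypothesis.ValiantsHypothesis.…` repeats a component by the D-0017 layout
-- (single-conjunct summit), which the `dupNamespace` linter flags; the name is mandated.
set_option linter.dupNamespace false

namespace Summit.ValiantsHypothesis.ValiantsHypothesis.Theorems.LacunarySymmetroidMatrixDescartes.Pivot.CriticalWindows.Lone

open Finset
open scoped BigOperators

/-! ## 1. The `w`-moment identity -/

/-- **`E[w·(g − c)] = (∑d)·σ·(σ − c)`** for `w = 2U − (U+R) + σ`, `g = U + R`, under `E U = E R = 0` and `E U² − E R² = (∑d)σ²`. [folklore] -/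
theorem w_moment {ι : Type*} (s : Finset ι) (d U R : ι → ℝ) (σ c : ℝ)
    (hEU : ∑ m ∈ s, d m * U m = 0) (hER : ∑ m ∈ s, d m * R m = 0)
    (hgap : (∑ m ∈ s, d m * U m ^ 2) - (∑ m ∈ s, d m * R m ^ 2) = (∑ m ∈ s, d m) * σ ^ 2) :
    ∑ m ∈ s, d m * (2 * U m - (U m + R m) + σ) * ((U m + R m) - c) = (∑ m ∈ s, d m) * σ * (σ - c) := by
  have hterm : ∀ m ∈ s, d m * (2 * U m - (U m + R m) + σ) * ((U m + R m) - c)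
      = (d m * U m ^ 2 - d m * R m ^ 2) + (σ - c) * (d m * U m) + (σ + c) * (d m * R m) - (σ * c) * d m := by
    intro m _; ring
  rw [Finset.sum_congr rfl hterm, Finset.sum_sub_distrib, Finset.sum_add_distrib, Finset.sum_add_distrib, Finset.sum_sub_distrib,
    ← Finset.mul_sum, ← Finset.mul_sum, ← Finset.mul_sum, hEU, hER, hgap]
  ring

/-! ## 2. The signs of `w` at the pivot and at the lone atom -/

/-- **`wₚ > 0`.**  Test the identity with `c = gⱼ`: the left terms are negative, the `j`-term vanishes, the total is positive. [folklore] -/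
theorem w_pivot_pos {ι : Type*} (s : Finset ι) (d U R : ι → ℝ) (σ : ℝ) (p j : ι) (hp : p ∈ s)
    (hd : ∀ m ∈ s, 0 < d m) (hσ : 0 < σ) (hUneg : ∀ m ∈ s, m ≠ p → U m < 0)
    (hgL : ∀ m ∈ s, m ≠ p → m ≠ j → σ ≤ U m + R m) (hgj : U j + R j < 0) (hgp : σ ≤ U p + R p)
    (hEU : ∑ m ∈ s, d m * U m = 0) (hER : ∑ m ∈ s, d m * R m = 0)
    (hgap : (∑ m ∈ s, d m * U m ^ 2) - (∑ m ∈ s, d m * R m ^ 2) = (∑ m ∈ s, d m) * σ ^ 2) :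
    0 < 2 * U p - (U p + R p) + σ := by
  classical
  have hid := w_moment s d U R σ (U j + R j) hEU hER hgap
  have hM : 0 < ∑ m ∈ s, d m := Finset.sum_pos hd ⟨p, hp⟩
  have htot : 0 < (∑ m ∈ s, d m) * σ * (σ - (U j + R j)) := mul_pos (mul_pos hM hσ) (by linarith)
  -- all terms with `m ≠ p` are `≤ 0`
  have hle : ∀ m ∈ s, m ≠ p → d m * (2 * U m - (U m + R m) + σ) * ((U m + R m) - (U j + R j)) ≤ 0 := by
    intro m hm hmp
    by_cases hmj : m = j
    · rw [hmj, sub_self, mul_zero]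
    · have hw : 2 * U m - (U m + R m) + σ < 0 := by linarith [hUneg m hm hmp, (hgL m hm hmp hmj)]
      have hg : 0 < (U m + R m) - (U j + R j) := by linarith [hgL m hm hmp hmj]
      exact (mul_neg_of_neg_of_pos (mul_neg_of_pos_of_neg (hd m hm) hw) hg).le
  have hsplit := Finset.add_sum_erase s (fun m => d m * (2 * U m - (U m + R m) + σ) * ((U m + R m) - (U j + R j))) hp
  have hrest : ∑ m ∈ s.erase p, d m * (2 * U m - (U m + R m) + σ) * ((U m + R m) - (U j + R j)) ≤ 0 :=
    Finset.sum_nonpos fun m hm => hle m (Finset.mem_of_mem_erase hm) (Finset.ne_of_mem_erase hm)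
  rw [hid] at hsplit
  have hpterm : 0 < d p * (2 * U p - (U p + R p) + σ) * ((U p + R p) - (U j + R j)) := by linarith
  have hg : 0 < (U p + R p) - (U j + R j) := by linarith
  have h1 : 0 < d p * (2 * U p - (U p + R p) + σ) := pos_of_mul_pos_left hpterm hg.le
  exact pos_of_mul_pos_right h1 (hd p hp).le

/-- **`wⱼ > 0`.**  Test the identity with `c = gₚ`: the left terms are non-negative, the `p`-term vanishes, the total is negative. [folklore] -/
theorem w_lone_pos {ι : Type*} (s : Finset ι) (d U R : ι → ℝ) (σ : ℝ) (p j : ι) (hp : p ∈ s) (hj : j ∈ s)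
    (hd : ∀ m ∈ s, 0 < d m) (hσ : 0 < σ) (hUneg : ∀ m ∈ s, m ≠ p → U m < 0)
    (hgL : ∀ m ∈ s, m ≠ p → m ≠ j → σ ≤ U m + R m ∧ U m + R m ≤ U p + R p) (hgj : U j + R j < 0) (hgp : σ < U p + R p)
    (hEU : ∑ m ∈ s, d m * U m = 0) (hER : ∑ m ∈ s, d m * R m = 0)
    (hgap : (∑ m ∈ s, d m * U m ^ 2) - (∑ m ∈ s, d m * R m ^ 2) = (∑ m ∈ s, d m) * σ ^ 2) :
    0 < 2 * U j - (U j + R j) + σ := by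
  classical
  have hid := w_moment s d U R σ (U p + R p) hEU hER hgap
  have hM : 0 < ∑ m ∈ s, d m := Finset.sum_pos hd ⟨p, hp⟩
  have htot : (∑ m ∈ s, d m) * σ * (σ - (U p + R p)) < 0 := mul_neg_of_pos_of_neg (mul_pos hM hσ) (by linarith)
  -- all terms with `m ≠ j` are `≥ 0`
  have hge : ∀ m ∈ s, m ≠ j → 0 ≤ d m * (2 * U m - (U m + R m) + σ) * ((U m + R m) - (U p + R p)) := by
    intro m hm hmj
    by_cases hmp : m = p
    · rw [hmp, sub_self, mul_zero]
    · obtain ⟨h1, h2⟩ := hgL m hm hmp hmj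
      have hw : 2 * U m - (U m + R m) + σ < 0 := by linarith [hUneg m hm hmp]
      exact mul_nonneg_of_nonpos_of_nonpos (mul_neg_of_pos_of_neg (hd m hm) hw).le (by linarith)
  have hsplit := Finset.add_sum_erase s (fun m => d m * (2 * U m - (U m + R m) + σ) * ((U m + R m) - (U p + R p))) hj
  have hrest : 0 ≤ ∑ m ∈ s.erase j, d m * (2 * U m - (U m + R m) + σ) * ((U m + R m) - (U p + R p)) :=
    Finset.sum_nonneg fun m hm => hge m (Finset.mem_of_mem_erase hm) (Finset.ne_of_mem_erase hm)
  rw [hid] at hsplit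
  have hjterm : d j * (2 * U j - (U j + R j) + σ) * ((U j + R j) - (U p + R p)) < 0 := by linarith
  have hg : (U j + R j) - (U p + R p) < 0 := by linarith
  by_contra hcon
  push Not at hcon
  have : 0 ≤ d j * (2 * U j - (U j + R j) + σ) * ((U j + R j) - (U p + R p)) :=
    mul_nonneg_of_nonpos_of_nonpos (mul_nonpos_of_nonneg_of_nonpos (hd j hj).le hcon) hg.le
  linarith

/-! ## 3. The cubic moment inequality for any rates -/

/-- **`E U³ − E[UR²] = E[U·w·(g − σ)]`** under `E U = E[UR] = 0`. [folklore] -/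
theorem phi_eq {ι : Type*} (s : Finset ι) (d U R : ι → ℝ) (σ : ℝ)
    (hEU : ∑ m ∈ s, d m * U m = 0) (hEUR : ∑ m ∈ s, d m * U m * R m = 0) :
    (∑ m ∈ s, d m * U m ^ 3) - (∑ m ∈ s, d m * U m * R m ^ 2)
      = ∑ m ∈ s, d m * U m * (2 * U m - (U m + R m) + σ) * ((U m + R m) - σ) := by
  have hterm : ∀ m ∈ s, d m * U m * (2 * U m - (U m + R m) + σ) * ((U m + R m) - σ)
      = (d m * U m ^ 3 - d m * U m * R m ^ 2) + (2 * σ) * (d m * U m * R m) - σ ^ 2 * (d m * U m) := by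
    intro m _; ring
  rw [Finset.sum_congr rfl hterm, Finset.sum_sub_distrib, Finset.sum_add_distrib, Finset.sum_sub_distrib,
    ← Finset.mul_sum, ← Finset.mul_sum, hEU, hEUR]
  ring

/-- **THE CUBIC MOMENT INEQUALITY FOR ANY RATES (any number of atoms).**  Masses `d > 0`; `E U = E R = E[UR] = 0`; `σ > 0` with
`E U² − E R² = (∑d)σ²`; pivot `p` with `Uₚ > 0`, every other atom `U < 0`; left atoms (`m ≠ p, j`) with `σ ≤ gₘ ≤ gₚ` (`g = U + R`),
`σ < gₚ`; lone atom `j ≠ p` with `gⱼ < 0`.  Then `E U³ > 3E[UR²]`.  (No hypothesis compares `Uⱼ` with the other `Uₘ`: the lone letter's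
rate is arbitrary.) [folklore] -/
theorem cubicMoment_pos_allRates {ι : Type*} (s : Finset ι) (d U R : ι → ℝ) (σ : ℝ) (p j : ι)
    (hp : p ∈ s) (hj : j ∈ s) (hd : ∀ m ∈ s, 0 < d m) (hσ : 0 < σ)
    (hUp : 0 < U p) (hUneg : ∀ m ∈ s, m ≠ p → U m < 0)
    (hgL : ∀ m ∈ s, m ≠ p → m ≠ j → σ ≤ U m + R m ∧ U m + R m ≤ U p + R p) (hgp : σ < U p + R p) (hgj : U j + R j < 0)
    (hEU : ∑ m ∈ s, d m * U m = 0) (hER : ∑ m ∈ s, d m * R m = 0) (hEUR : ∑ m ∈ s, d m * U m * R m = 0)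
    (hgap : (∑ m ∈ s, d m * U m ^ 2) - (∑ m ∈ s, d m * R m ^ 2) = (∑ m ∈ s, d m) * σ ^ 2) :
    0 < (∑ m ∈ s, d m * U m ^ 3) - 3 * (∑ m ∈ s, d m * U m * R m ^ 2) := by
  classical
  have hwp := w_pivot_pos s d U R σ p j hp hd hσ hUneg (fun m hm hmp hmj => (hgL m hm hmp hmj).1) hgj hgp.le hEU hER hgap
  have hwj := w_lone_pos s d U R σ p j hp hj hd hσ hUneg hgL hgj hgp hEU hER hgap
  have hQ := mixedCubic_nonpos s d U R p (fun m hm => (hd m hm).le) (fun m hm hmp => (hUneg m hm hmp).le) hEU hEUR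
  -- `Φ = E U³ − E[UR²] > 0` termwise
  have hPhi : 0 < (∑ m ∈ s, d m * U m ^ 3) - (∑ m ∈ s, d m * U m * R m ^ 2) := by
    rw [phi_eq s d U R σ hEU hEUR]
    refine Finset.sum_pos' ?_ ⟨p, hp, ?_⟩
    · intro m hm
      by_cases hmp : m = p
      · rw [hmp]
        exact (mul_pos (mul_pos (mul_pos (hd p hp) hUp) hwp) (by linarith)).le
      · by_cases hmj : m = j
        · rw [hmj]
          have h1 : d j * U j * (2 * U j - (U j + R j) + σ) < 0 :=
            mul_neg_of_neg_of_pos (mul_neg_of_pos_of_neg (hd j hj) (hUneg j hj (hmj ▸ hmp))) hwj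
          exact (mul_pos_of_neg_of_neg h1 (by linarith)).le
        · obtain ⟨h1, h2⟩ := hgL m hm hmp hmj
          have hw : 2 * U m - (U m + R m) + σ < 0 := by linarith [hUneg m hm hmp]
          have h3 : 0 < d m * U m * (2 * U m - (U m + R m) + σ) :=
            mul_pos_of_neg_of_neg (mul_neg_of_pos_of_neg (hd m hm) (hUneg m hm hmp)) hw
          exact mul_nonneg h3.le (by linarith)
    · exact mul_pos (mul_pos (mul_pos (hd p hp) hUp) hwp) (by linarith)
  by_cases h3 : 0 < ∑ m ∈ s, d m * U m ^ 3
  · linarith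
  · linarith

/-! ## 4. The cubic fold inequality for any rates -/

/-- **`𝒞_W > 0` AT FOLD POINTS — ANY RATES, ANY NUMBER OF LETTERS.**  As `…LoneFoldCubic.foldCubic_pos` but WITHOUT the hypothesis that
the lone letter is fastest: letters `m ∈ s` with point weights `Wₘ > 0`; pivot `p` with `βₚ < 0`, all other rates positive; lone letter
`j ≠ p`; positions `0 < tₘ`, `tₘ ≤ tₚ` for the left letters (possibly none), `tₚ < T < tⱼ`; (E1), (E2), fold ⇒ `3B₀S₂² − 6B₂S₁S₂ + 2B₃S₁² > 0`.
[folklore] -/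
theorem foldCubic_pos_allRates {ι : Type*} (s : Finset ι) (β t W : ι → ℝ) (T : ℝ) (p j : ι)
    (hp : p ∈ s) (hj : j ∈ s) (hpj : p ≠ j)
    (hW : ∀ m ∈ s, 0 < W m) (hβp : β p < 0) (hβ : ∀ m ∈ s, m ≠ p → 0 < β m)
    (ht : ∀ m ∈ s, 0 < t m) (htp : ∀ m ∈ s, m ≠ p → m ≠ j → t m ≤ t p) (hpT : t p < T) (hTj : T < t j)
    (h1 : ∑ m ∈ s, W m * (T ^ 2 - t m ^ 2) = 0) (h2 : ∑ m ∈ s, β m * W m * (T - t m) ^ 2 = 0)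
    (hfold : (∑ m ∈ s, W m) * (∑ m ∈ s, β m ^ 2 * W m * (T - t m) ^ 2) = 2 * (∑ m ∈ s, β m * W m * (T - t m)) ^ 2) :
    0 < 3 * (∑ m ∈ s, β m * W m) * (∑ m ∈ s, β m ^ 2 * W m * (T - t m) ^ 2) ^ 2
        - 6 * (∑ m ∈ s, β m ^ 2 * W m * (T - t m)) * (∑ m ∈ s, β m * W m * (T - t m)) * (∑ m ∈ s, β m ^ 2 * W m * (T - t m) ^ 2)
        + 2 * (∑ m ∈ s, β m ^ 3 * W m * (T - t m) ^ 2) * (∑ m ∈ s, β m * W m * (T - t m)) ^ 2 := by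
  -- positions relative to the direction
  have hleft_lt : ∀ m ∈ s, m ≠ j → 0 < t m ∧ t m < T := by
    intro m hm hmj
    refine ⟨ht m hm, ?_⟩
    by_cases hmp : m = p
    · rw [hmp]; exact hpT
    · exact lt_of_le_of_lt (htp m hm hmp hmj) hpT
  have hu : ∀ m ∈ s, T - t m ≠ 0 := by
    intro m hm
    by_cases hmj : m = j
    · rw [hmj]; exact ne_of_lt (by linarith)
    · exact ne_of_gt (by linarith [(hleft_lt m hm hmj).2])
  have hT : 0 < T := lt_trans (ht p hp) hpT
  -- names for the basic sums
  set A := ∑ m ∈ s, W m with hA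
  set S1 := ∑ m ∈ s, β m * W m * (T - t m) with hS1
  set S2 := ∑ m ∈ s, β m ^ 2 * W m * (T - t m) ^ 2 with hS2
  set Sbg := ∑ m ∈ s, β m * W m * (T ^ 2 - t m ^ 2) with hSbg
  set B0 := ∑ m ∈ s, β m * W m with hB0
  set B2 := ∑ m ∈ s, β m ^ 2 * W m * (T - t m) with hB2
  set B3 := ∑ m ∈ s, β m ^ 3 * W m * (T - t m) ^ 2 with hB3
  set M := ∑ m ∈ s, W m * (T - t m) ^ 2 with hM
  -- signs of the basic sums
  have hβj : 0 < β j := hβ j hj hpj.symm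
  have hS2pos : 0 < S2 := secondMoment_pos s β t W T j hj (fun m hm => (hW m hm).le) (hW j hj) (ne_of_gt hβj) (ne_of_lt hTj)
  have hSbg_eq : Sbg = 2 * T * S1 := by
    have := mixedMoment_eq s β t W T
    rw [h2, sub_zero] at this
    exact this
  have hS1neg' : S1 < 0 :=
    firstMoment_neg s β t W T p j hj hW (fun m hm hmp => (hβ m hm hmp).le) hβj htp hpT hTj h2
  have hSbg_neg : Sbg < 0 := by
    rw [hSbg_eq]; exact mul_neg_of_pos_of_neg (by linarith) hS1neg'
  have hMpos : 0 < M := by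
    refine Finset.sum_pos' (fun m hm => mul_nonneg (hW m hm).le (sq_nonneg _)) ⟨p, hp, ?_⟩
    exact mul_pos (hW p hp) (pow_pos (by linarith) 2)
  -- the abstract data
  have hd : ∀ m ∈ s, 0 < W m * (T - t m) ^ 2 := by
    intro m hm
    have h := hu m hm
    have : 0 < (T - t m) ^ 2 := by positivity
    exact mul_pos (hW m hm) this
  have hUneg : ∀ m ∈ s, m ≠ p → Sbg * β m < 0 := fun m hm hmp => mul_neg_of_neg_of_pos hSbg_neg (hβ m hm hmp)
  have hUp : 0 < Sbg * β p := mul_pos_of_neg_of_neg hSbg_neg hβp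
  have hEU : ∑ m ∈ s, (W m * (T - t m) ^ 2) * (Sbg * β m) = 0 := by
    rw [bridge_EU s β t W T Sbg, h2, mul_zero]
  have hER : ∑ m ∈ s, (W m * (T - t m) ^ 2) * ((S2 * (T + t m) - Sbg * β m * (T - t m)) / (T - t m)) = 0 := by
    rw [bridge_ER s β t W T Sbg S2 hu, h1, h2, mul_zero, mul_zero, sub_zero]
  have hEUR : ∑ m ∈ s, (W m * (T - t m) ^ 2) * (Sbg * β m) * ((S2 * (T + t m) - Sbg * β m * (T - t m)) / (T - t m)) = 0 := by
    rw [bridge_EUR s β t W T Sbg S2 hu, ← hSbg, ← hS2]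
    ring
  -- the `g`'s
  have hg : ∀ m ∈ s, Sbg * β m + (S2 * (T + t m) - Sbg * β m * (T - t m)) / (T - t m) = S2 * ((T + t m) / (T - t m)) :=
    fun m hm => atom_g Sbg S2 (β m) (t m) T (hu m hm)
  have horder : ∀ m ∈ s, m ≠ p → m ≠ j → Sbg * β m + (S2 * (T + t m) - Sbg * β m * (T - t m)) / (T - t m)
      ≤ Sbg * β p + (S2 * (T + t p) - Sbg * β p * (T - t p)) / (T - t p) := by
    intro m hm hmp hmj
    rw [hg m hm, hg p hp]
    refine mul_le_mul_of_nonneg_left ?_ hS2pos.le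
    obtain ⟨h0, hlt⟩ := hleft_lt m hm hmj
    have hmp' := htp m hm hmp hmj
    rw [div_le_div_iff₀ (by linarith) (by linarith)]
    have e : (T + t p) * (T - t m) - (T + t m) * (T - t p) = 2 * T * (t p - t m) := by ring
    have : 0 ≤ 2 * T * (t p - t m) := mul_nonneg (by linarith) (by linarith)
    linarith
  -- the GAP from the fold relation
  have hQR : (∑ m ∈ s, (W m * (T - t m) ^ 2) * (Sbg * β m) ^ 2)
      - (∑ m ∈ s, (W m * (T - t m) ^ 2) * ((S2 * (T + t m) - Sbg * β m * (T - t m)) / (T - t m)) ^ 2) = M * S2 ^ 2 := by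
    rw [bridge_U2 s β t W T Sbg, bridge_R2 s β t W T Sbg S2 hu, aux_Q s t W T, h1, ← hS2, ← hSbg, ← hA, ← hM]
    have hf : A * S2 - 2 * S1 ^ 2 = 0 := by rw [hfold]; ring
    linear_combination (2 * S2 * (Sbg + 2 * T * S1)) * hSbg_eq + (-(4 * T ^ 2 * S2)) * hf
  -- the abstract inequality
  -- the lone atom's `g` is negative, the pivot's exceeds `σ = S₂`, the left ones lie in `[σ, g_p]`
  have hgj : Sbg * β j + (S2 * (T + t j) - Sbg * β j * (T - t j)) / (T - t j) < 0 := by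
    rw [hg j hj]
    exact mul_neg_of_pos_of_neg hS2pos (div_neg_of_pos_of_neg (by linarith [ht j hj]) (by linarith))
  have hgp' : S2 < Sbg * β p + (S2 * (T + t p) - Sbg * β p * (T - t p)) / (T - t p) := by
    rw [hg p hp]
    have hlt : 1 < (T + t p) / (T - t p) := by rw [lt_div_iff₀ (by linarith)]; linarith [ht p hp]
    calc S2 = S2 * 1 := (mul_one _).symm
      _ < S2 * ((T + t p) / (T - t p)) := mul_lt_mul_of_pos_left hlt hS2pos
  have hgL : ∀ m ∈ s, m ≠ p → m ≠ j → S2 ≤ Sbg * β m + (S2 * (T + t m) - Sbg * β m * (T - t m)) / (T - t m) ∧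
      Sbg * β m + (S2 * (T + t m) - Sbg * β m * (T - t m)) / (T - t m)
        ≤ Sbg * β p + (S2 * (T + t p) - Sbg * β p * (T - t p)) / (T - t p) := by
    intro m hm hmp hmj
    refine ⟨?_, horder m hm hmp hmj⟩
    rw [hg m hm]
    obtain ⟨h0, hlt⟩ := hleft_lt m hm hmj
    have hle : 1 ≤ (T + t m) / (T - t m) := by rw [le_div_iff₀ (by linarith)]; linarith
    calc S2 = S2 * 1 := (mul_one _).symm
      _ ≤ S2 * ((T + t m) / (T - t m)) := mul_le_mul_of_nonneg_left hle hS2pos.le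
  have main := cubicMoment_pos_allRates s (fun m => W m * (T - t m) ^ 2) (fun m => Sbg * β m)
    (fun m => (S2 * (T + t m) - Sbg * β m * (T - t m)) / (T - t m)) S2 p j hp hj hd hS2pos hUp hUneg hgL hgp' hgj hEU hER hEUR
    (by rw [hQR, hM])
  -- translate the conclusion
  rw [bridge_U3 s β t W T Sbg, bridge_UR2 s β t W T Sbg S2 hu, aux_Q1 s β t W T, aux_Q2 s β t W T, h2, add_zero,
    ← hB3, ← hB0, ← hS1, ← hB2, ← hS2] at main
  rw [hSbg_eq] at main
  have key : (2 * T * S1) ^ 3 * B3 - 3 * (2 * T * S1 * ((S2 ^ 2 * (4 * T ^ 2 * B0 - 4 * T * S1)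
      - 2 * S2 * (2 * T * S1) * (2 * T * B2 - S2) + (2 * T * S1) ^ 2 * B3)))
      = (-(8 * T ^ 3 * S1)) * (3 * B0 * S2 ^ 2 - 6 * B2 * S1 * S2 + 2 * B3 * S1 ^ 2) := by ring
  rw [key] at main
  have hS1neg : S1 < 0 := by
    rw [hSbg_eq] at hSbg_neg
    by_contra hcon
    push Not at hcon
    have : 0 ≤ 2 * T * S1 := mul_nonneg (by linarith) hcon
    linarith
  have hcoef : 0 < -(8 * T ^ 3 * S1) := by
    have : 8 * T ^ 3 * S1 < 0 := mul_neg_of_pos_of_neg (by positivity) hS1neg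
    linarith
  exact pos_of_mul_pos_right main hcoef.le


/-! ## 5. The lone-letter law for any rates, both sides -/

/-- **THE LONE-LETTER LAW — ANY RATES, ANY NUMBER OF LETTERS (right side).**  Pivot `p` (rate `βₚ < 0`), left letters (`m ≠ p, j`, at least one)
at `0 < tₘ < tₚ` with positive rates, ONE lone letter `j` at `tⱼ > tₚ` with positive rate — no comparison between `βⱼ` and the other rates —
exponents `dₘ − dₚ = λ(βₘ − βₚ)`, `λ > 0`, any positive weights: no three critical points with `tₚ < T₁ < T₂ < T₃`. [folklore] -/
theorem lone_letter_right_allRates {ι : Type*} (s : Finset ι) (β t w : ι → ℝ) (d : ι → ℕ) (p j : ι) (lam : ℝ)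
    (hp : p ∈ s) (hj : j ∈ s) (hpj : p ≠ j) (hleft : ∃ m ∈ s, m ≠ p ∧ m ≠ j)
    (hw : ∀ m ∈ s, 0 < w m) (hβp : β p < 0) (hβ : ∀ m ∈ s, m ≠ p → 0 < β m)
    (ht : ∀ m ∈ s, 0 < t m) (htp : ∀ m ∈ s, m ≠ p → m ≠ j → t m < t p) (hpj' : t p < t j)
    (hlam : 0 < lam) (hd : ∀ m ∈ s, (d m : ℝ) - (d p : ℝ) = lam * (β m - β p))
    {x₁ x₂ x₃ T₁ T₂ T₃ : ℝ} (hx₁ : 0 < x₁) (hx₂ : 0 < x₂) (hx₃ : 0 < x₃)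
    (h01 : t p < T₁) (h12 : T₁ < T₂) (h23 : T₂ < T₃)
    (c₁ : ∑ m ∈ s, w m * x₁ ^ d m * (T₁ ^ 2 - t m ^ 2) = 0) (c₁' : ∑ m ∈ s, β m * (w m * x₁ ^ d m) * (T₁ - t m) ^ 2 = 0)
    (c₂ : ∑ m ∈ s, w m * x₂ ^ d m * (T₂ ^ 2 - t m ^ 2) = 0) (c₂' : ∑ m ∈ s, β m * (w m * x₂ ^ d m) * (T₂ - t m) ^ 2 = 0)
    (c₃ : ∑ m ∈ s, w m * x₃ ^ d m * (T₃ ^ 2 - t m ^ 2) = 0) (c₃' : ∑ m ∈ s, β m * (w m * x₃ ^ d m) * (T₃ - t m) ^ 2 = 0) :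
    False := by
  have htp' : ∀ m ∈ s, m ≠ p → m ≠ j → t m ≤ t p := fun m hm hmp hmj => (htp m hm hmp hmj).le
  refine lone_letter_right_of_foldCubic_pos s β t w d p j lam hp hj hpj hleft hw hβp hβ ht htp hpj' hlam hd ?_
    hx₁ hx₂ hx₃ h01 h12 h23 c₁ c₁' c₂ c₂' c₃ c₃'
  intro T W hT hTj hW e1 e2 efold
  exact foldCubic_pos_allRates s β t W T p j hp hj hpj hW hβp hβ ht htp' hT hTj e1 e2 efold

/-- **THE LONE-LETTER LAW — ANY RATES, ANY NUMBER OF LETTERS (left side)**, by the inversion symmetry of `…LoneLetterLeft`: pivot `p`, ONE lone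
letter `j` at `0 < tⱼ < tₚ` with any positive rate, all other letters (at least one) above the pivot: no three critical points with
`0 < T₁ < T₂ < T₃ < tₚ`. [folklore] -/
theorem lone_letter_left_allRates {ι : Type*} (s : Finset ι) (β t w : ι → ℝ) (d : ι → ℕ) (p j : ι) (lam : ℝ)
    (hp : p ∈ s) (hj : j ∈ s) (hpj : p ≠ j) (hleft : ∃ m ∈ s, m ≠ p ∧ m ≠ j)
    (hw : ∀ m ∈ s, 0 < w m) (hβp : β p < 0) (hβ : ∀ m ∈ s, m ≠ p → 0 < β m)
    (ht : ∀ m ∈ s, 0 < t m) (htp : ∀ m ∈ s, m ≠ p → m ≠ j → t p < t m) (hjp : t j < t p)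
    (hlam : 0 < lam) (hd : ∀ m ∈ s, (d m : ℝ) - (d p : ℝ) = lam * (β m - β p))
    {x₁ x₂ x₃ T₁ T₂ T₃ : ℝ} (hx₁ : 0 < x₁) (hx₂ : 0 < x₂) (hx₃ : 0 < x₃)
    (hT₁ : 0 < T₁) (h12 : T₁ < T₂) (h23 : T₂ < T₃) (h3p : T₃ < t p)
    (c₁ : ∑ m ∈ s, w m * x₁ ^ d m * (T₁ ^ 2 - t m ^ 2) = 0) (c₁' : ∑ m ∈ s, β m * (w m * x₁ ^ d m) * (T₁ - t m) ^ 2 = 0)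
    (c₂ : ∑ m ∈ s, w m * x₂ ^ d m * (T₂ ^ 2 - t m ^ 2) = 0) (c₂' : ∑ m ∈ s, β m * (w m * x₂ ^ d m) * (T₂ - t m) ^ 2 = 0)
    (c₃ : ∑ m ∈ s, w m * x₃ ^ d m * (T₃ ^ 2 - t m ^ 2) = 0) (c₃' : ∑ m ∈ s, β m * (w m * x₃ ^ d m) * (T₃ - t m) ^ 2 = 0) :
    False := by
  have hT₂ : 0 < T₂ := lt_trans hT₁ h12
  have hT₃ : 0 < T₃ := lt_trans hT₂ h23
  have htp0 : 0 < t p := ht p hp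
  have htne : ∀ m ∈ s, t m ≠ 0 := fun m hm => ne_of_gt (ht m hm)
  obtain ⟨e₁, e₁'⟩ := critical_inversion s β t w d (ne_of_gt hT₁) htne c₁ c₁'
  obtain ⟨e₂, e₂'⟩ := critical_inversion s β t w d (ne_of_gt hT₂) htne c₂ c₂'
  obtain ⟨e₃, e₃'⟩ := critical_inversion s β t w d (ne_of_gt hT₃) htne c₃ c₃'
  exact lone_letter_right_allRates s β (fun m => 1 / t m) (fun m => w m * t m ^ 2) d p j lam hp hj hpj hleft
    (fun m hm => mul_pos (hw m hm) (pow_pos (ht m hm) 2)) hβp hβ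
    (fun m hm => one_div_pos.mpr (ht m hm)) (fun m hm hmp hmj => one_div_lt_one_div_of_lt htp0 (htp m hm hmp hmj))
    (one_div_lt_one_div_of_lt (ht j hj) hjp) hlam hd hx₃ hx₂ hx₁
    (one_div_lt_one_div_of_lt hT₃ h3p) (one_div_lt_one_div_of_lt hT₂ h23) (one_div_lt_one_div_of_lt hT₁ h12)
    e₃ e₃' e₂ e₂' e₁ e₁'

end Summit.ValiantsHypothesis.ValiantsHypothesis.Theorems.LacunarySymmetroidMatrixDescartes.Pivot.CriticalWindows.Lone
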